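import Summits.BirchSwinnertonDyer.BirchSwinnertonDyer.Theorems.AdditiveBranchIMCGordTwoTwistedFlatTwo
import Summits.BirchSwinnertonDyer.BirchSwinnertonDyer.Theorems.AdditiveBranchIMCGordTwoTwistedSocketLoose
import Summits.BirchSwinnertonDyer.BirchSwinnertonDyer.Theorems.AdditiveBranchIMCGordTwoTwistedWaldspurgerFrameTwo
import HarnessLib

/-!
# Route `AdditiveBranchIMC`, crux `GordTwoRankZeroOffCaseOne` (19357), line `three_field_road`, DOOR D («`ℓ₀ = 2` as the `K`-ramified twisted Wan
# prime», LeadReport27 §5 item 1): the BRANCH SOCKET over a DYADIC twisted road field (LEAD g19; `--supports` 19357, helper only)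

The `ℓ₀ = 2` sibling of `AdditiveBranchIMCGordTwoTwistedSocketLoose.lean` (LEAD g18, p816900; itself the port of
`WanAnyRoad.branchSocketAt_of_flatInclusionUnit_wanAny`), VERBATIM with the field hypothesis `TameRoadFieldTwistedLoose W p q K` REPLACED by
`TameRoadFieldTwistedTwo W p t K` (p819191), the R4 data re-keyed to `W₁ ≅ E^{(t)}` (`C • E^{(t)} = W₁`, `IsRationalCharacterFor νgal t`), and the
three typed inputs replaced by their dyadic siblings R2₂ (wi-101331, through `flatInclusion_twisted_two`), R3₂ (wi-101332, through
`exists_frameInt_unitContent_twisted_two`), R4₂ (wi-101333, through `TameWaldspurger.intSeries_value_of_frame_manin_twisted_two`). NO unit cut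
(`p ∤ 2 + 1` automatic for `p ≥ 5`); the signature drops `{q}`, `hcut`, `h2tt`, `hmodP` against the loose sibling.
* `branchSocket_twisted_two`.
Theorems only (no definition, no named fact, no `sorry`); 19357 / 19358 stay OPEN; BSD is proved for no curve.
References: [JetchevSkinnerWan2017] §7.4.1, Thm. 3.3.1; [Hsieh2014] Thm. B; [LiuZhangZhang2018] Thm 1.5.1/1.5.3; [Castella2018] Thm. 2.3, §5;
[CastellaLiuWan2022] Thm. 8.2.1. presearch: n/a (kernel port over typed readings).
-/

set_option autoImplicit false
set_option linter.dupNamespace false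

noncomputable section

open scoped Classical
open NumberField IsDedekindDomain IsDedekindDomain.HeightOneSpectrum Rat.HeightOneSpectrum
open WeierstrassCurve Literature.NumberTheory.EllipticCurves
open Literature.NumberTheory.EllipticCurves.Rank1Residual
open Literature.NumberTheory.QuadraticFields
open Summit.BirchSwinnertonDyer.Rank1Residual
open Summit.BirchSwinnertonDyer.Rank1Residual.Additive
open Summit.BirchSwinnertonDyer.BirchSwinnertonDyer.Theorems
open ThreeFieldRoadSupply

namespace Summit.BirchSwinnertonDyer.BirchSwinnertonDyer.Theorems.TwistedWanRoad

section Socket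

open WeierstrassCurve NumberField IsDedekindDomain Field PowerSeries
  Literature.NumberTheory.EllipticCurves
  Literature.NumberTheory.EllipticCurves.ModularForms
  Literature.NumberTheory.EllipticCurves.Rank1Residual
  Literature.NumberTheory.EllipticCurves.Rank1Residual.Typed
  Literature.NumberTheory.EllipticCurves.GreenbergVatsal2000
  Literature.NumberTheory.EllipticCurves.LiuZhangZhang2018
  Literature.NumberTheory.EllipticCurves.CaiShuTian2014
  Literature.NumberTheory.GaloisRepresentations
  Literature.NumberTheory.GaloisCohomology
  Summit.BirchSwinnertonDyer.Rank1Residual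
  Summit.BirchSwinnertonDyer.Rank1Residual.Additive
  Summit.BirchSwinnertonDyer.Rank1Residual.X11b
  Summit.BirchSwinnertonDyer.Rank1Residual.X11b.AcSelmer
  Summit.BirchSwinnertonDyer.Rank1Residual.X11b.Halves
  Summit.BirchSwinnertonDyer.Rank1Residual.X11b.CongruenceLimit
  Summit.BirchSwinnertonDyer.BirchSwinnertonDyer.Theorems.SchneiderFree
  Summit.BirchSwinnertonDyer.BirchSwinnertonDyer.Theorems.SchneiderFreeControlAtoms
  Summit.BirchSwinnertonDyer.BirchSwinnertonDyer.Theorems.UniversalToricDescentWaldspurgerFlat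
open TameBranchSocket TameJointLower TameWaldspurger WanAnyRoad

/-- **THE BRANCH SOCKET OVER A DYADIC TWISTED ROAD FIELD AT THE DESCENDED `ν`-HEEGNER POINT** (the `ℓ₀ = 2` sibling of
`branchSocket_twisted_loose`). Data: `W/ℚ` globally minimal on cell (G-ord, `e = 2`), `p ≥ 5`, `ρ̄` onto, odd additive primes of twist type; a DYADIC
twisted road field `K` (`TameRoadFieldTwistedTwo W p t K`: `E` additive at `2`, `W₁ = E^{(t)}` multiplicative at `2`, `2` ramified in `K` in the
non-split genus class); `Wd ≅ E^{(d_K)}` globally minimal with `r_an(E) + r_an(Wd) = 1`; the R4₂ data — the globally minimal `W₁` with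
`C • E^{(t)} = W₁` and its parametrisation `Dt₁ : X₀(N₁) → W₁`, an infinite place `w₀`, `β` with `4N₁ ∣ β² − d_K`, the conductor-`1` Heegner point
`y ∈ W₁(H_K)`, the genus character `ν` of `t` (i.e. of `t* = 4t`) with its Galois character —; a point `Q ∈ E(K)` of infinite order and the TRANSPORT
HYPOTHESIS `hHT`; the typed readings R2₂ (`h821`, `h61`), R3₂ (`hB`), R4₂ (`hL`), `hGZK`. CONCLUSION: for every parametrisation `Dt` of `E` of
level `N_E` and every anticyclotomic frame `(κ, γ, 𝔭)` with `𝔭 ∣ p` of degree one, `SchneiderFree.AdditiveIMCLowerBDPOnTreeLeAt p κ 𝔭 γ (embAt K p 𝔭)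
(v_p c₁) Q`, `c₁ = Dt₁.c`. CONDITIONAL; closes nothing by itself. [cite: JetchevSkinnerWan2017, §7.4.1 and Thm. 3.3.1 (arXiv:1512.06894 pp. 11–14, 30)]
[cite: Hsieh2014, Thm. B p. 713 (Doc. Math. 19), §3.5 (R1) (arXiv:1112.1580 p. 11)]
[cite: LiuZhangZhang2018, Thm 1.5.1 and Thm 1.5.3 (Duke Math. J. 167 pp. 748–749)]
[cite: Castella2018, Thm. 2.3 and §5 (5.1)–(5.3) (arXiv:1704.06608 pp. 5, 12)] -/
theorem branchSocket_twisted_two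
    (hB : Hsieh2014.thmB_exists_isHsiehLFunction_coeff_norm_eq_one_unrPeriod_ramifiedTwistedSteinbergAtTwo)
    (hL : thm151_thm153_modularCurve_heegnerVector_additive_ramifiedTwistedAtTwo)
    (h821 : CastellaLiuWan2022.thm821_XGr₂_charIdeal_mul_le_awayFromCyc_semistableTwistRamifiedAtTwo)
    (h61 : CastellaLiuWan2022.sec61_exists_isCastellaLiuWanLFunction₂_semistableTwistRamifiedAtTwo)
    (hGZK : rank_eq_analyticRank_of_analyticRank_le_one)
    (W : WeierstrassCurve ℚ) [W.IsElliptic] [W.IsGloballyMinimal] (p : ℕ) [Fact p.Prime]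
    {t : ℤ} (K : Type) [Field K] [NumberField K]
    (Wd : WeierstrassCurve ℚ) [Wd.IsElliptic] [Wd.IsGloballyMinimal]
    (hcell : N10.CellGordTwo W p) (h5 : 5 ≤ p) (hsurj : Surj W p)
    (htt : ∀ r : Nat.Primes, (r : ℕ) ≠ 2 → W.HasAdditiveReductionAt ((primesEquiv (R := ℤ)).symm r) →
      ¬ (W.quadraticTwist (((-1 : ℤ) ^ ((r : ℕ) / 2) * r : ℤ) : ℚ)).HasAdditiveReductionAt
        ((primesEquiv (R := ℤ)).symm r))
    (hK : TameRoadFieldTwistedTwo W p t K)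
    (htw : ∃ Cd : VariableChange ℚ, Cd • W.quadraticTwist (NumberField.discr K : ℚ) = Wd)
    (hsum : W.analyticRank + Wd.analyticRank = 1)
    -- the R4₂ data: `W₁ ≅ E^{(t)}`, `Dt₁`, `w₀`, `β`, `y`, `ν`
    (W₁ : WeierstrassCurve ℚ) [W₁.IsElliptic] [W₁.IsGloballyMinimal]
    [(W₁.baseChange ℂ_[p]).IsIntegral (NormedField.valuation (K := ℂ_[p])).integer]
    (C : VariableChange ℚ) (hC : C • W.quadraticTwist (t : ℚ) = W₁)
    {N₁ : ℕ} [NeZero N₁] (Dt₁ : ModularParametrizationData W₁ N₁) (hN₁ : W₁.conductorNorm ℤ = N₁)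
    (w₀ : InfinitePlace K) (β : ℤ) (hβ : 4 * (N₁ : ℤ) ∣ β ^ 2 - NumberField.discr K)
    (y : (W₁.baseChange (ringClassField K w₀.embedding 1)).toAffine.Point)
    (hy : WeierstrassCurve.Affine.Point.map (ringClassField K w₀.embedding 1).subtype.toRatAlgHom y =
      heegnerPointComplexOfConductor Dt₁ (NumberField.discr K) β 1)
    (ν : ringClassGal w₀.embedding 1 →* ℂˣ) (νgal : absoluteGaloisGroup K →ₜ* ℂˣ)
    (emb : ringClassField K w₀.embedding 1 →+* AlgebraicClosure K)
    (hemb : ∀ k : K, emb (algebraMap K (ringClassField K w₀.embedding 1) k) = algebraMap K (AlgebraicClosure K) k)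
    (hinfl : IsInflationAlong w₀.embedding 1 emb ν νgal)
    (hrat : Gross2004.IsRationalCharacterFor νgal t)
    -- the descended point and the transport hypothesis
    (Q : (W.baseChange K).toAffine.Point) (hQnt : ¬ IsOfFinAddOrder Q)
    (hHT : ∀ (ι' : PadicAlgCl p ≃+* ℂ) (𝔭' : HeightOneSpectrum (𝓞 K)) (h𝔭' : ((p : ℕ) : 𝓞 K) ∈ 𝔭'.asIdeal)
      (he' : 𝔭'.asIdeal.ramificationIdx (𝓞 ℚ) = 1) (hf' : 𝔭'.asIdeal.inertiaDeg (𝓞 ℚ) = 1),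
      (∀ (w : InfinitePlace K) (k : 𝓞 K), k ∈ 𝔭'.asIdeal ↔ ‖ι'.symm (w.embedding (k : K))‖ < 1) →
      ∃ lam : ℂ_[p], ‖lam‖ = 1 ∧ heegnerCharLogSum ι' w₀.embedding 1 W₁ ν y =
        lam * algebraMap ℚ_[p] ℂ_[p] (logOmega W p (embAt K p 𝔭' h𝔭' he' hf') Q)) :
    ∀ (N : ℕ) [NeZero N] (Dt : ModularParametrizationData W N), W.conductorNorm ℤ = N →
      ∀ (κ : ZpExtension K p), κ.IsAnticyclotomic →
        ∀ (γ : Field.absoluteGaloisGroup K) [Fact (κ.IsTopGenerator γ)]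
          (𝔭 : HeightOneSpectrum (𝓞 K)) (h𝔭 : ((p : ℕ) : 𝓞 K) ∈ 𝔭.asIdeal)
          (he : 𝔭.asIdeal.ramificationIdx (𝓞 ℚ) = 1) (hf : 𝔭.asIdeal.inertiaDeg (𝓞 ℚ) = 1),
          SchneiderFree.AdditiveIMCLowerBDPOnTreeLeAt p κ 𝔭 γ (X11b.embAt K p 𝔭 h𝔭 he hf)
            (padicValNat p Dt₁.c.natAbs) Q := by
  intro N _ Dt hN κ hκ γ _ 𝔭 h𝔭 he hf
  have hp : p.Prime := Fact.out
  have hp2 : p ≠ 2 := by omega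
  have hadd : Addv W p := hcell.2.1
  have hbc := baseChange_nonsplit_two_of_tameRoadFieldTwistedTwo W p t K hK
  have h2d : (2 : ℤ) ∣ NumberField.discr K := two_dvd_discr_of_nonsplitClassAtTwo W t K hK.2.2.2.1
  obtain ⟨hKiq, hd4, hqT, -, hsplitq, hHp⟩ := id hK
  obtain ⟨-, ht, -, hmult₂⟩ := hqT
  -- the unit cut at `ℓ₀ = 2` is automatic: `p ∤ 3` for `p ≥ 5`
  have hcut : ¬ p ∣ 2 + 1 := fun h ↦ by
    have := Nat.le_of_dvd (by norm_num) h
    omega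
  have h2f : Module.finrank ℚ K = 2 := hKiq.1
  haveI : IsTotallyComplex K := hKiq.2
  haveI hEK : (W.baseChange K).IsElliptic := by rw [baseChange]; infer_instance
  have hD0 : (NumberField.discr K : ℚ) ≠ 0 := by exact_mod_cast NumberField.discr_ne_zero K
  haveI hEt : (W.quadraticTwist (NumberField.discr K : ℚ)).IsElliptic := W.isElliptic_quadraticTwist hD0
  obtain ⟨Cd, hWd⟩ := htw
  -- (irr_K) from `Surj`, `p ≠ 2`, `K` quadratic
  have hirr : ∀ ρ : ModPGaloisRep K (ZMod p) 2, (W.baseChange K).IsTorsionGaloisRep p ρ →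
      FramedRep.IsAbsolutelyIrreducible ρ :=
    fun ρ hρ ↦ SignedBaseChangeK1FrameData.irrK_framed_of_surj W p hp2 hsurj K h2f ρ hρ
  -- `p` splits, `p ∣ N`, `p² ∣ N`, `p ∤ #𝓞_K^×`
  have hsplit : SplitsIn K p := hHp p hp (dvd_refl p)
  have hpN : p ∣ W.conductorNorm ℤ :=
    (W.dvd_conductorNorm_iff_not_hasGoodReductionAtPrime p).mpr hadd.1
  have hpN' : p ∣ N := by rw [← hN]; exact hpN
  have hp2N : p ^ 2 ∣ N := by
    rw [← hN]
    by_contra h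
    rcases hasGoodReductionAtPrime_or_hasMultiplicativeReductionAtPrime_of_not_sq_dvd_conductorNorm (V := W) h
      with hg | hm
    · exact hadd.1 hg
    · exact hadd.2 hm
  have hunit : ¬ p ∣ Units.torsionOrder K := by
    rw [Literature.NumberTheory.QuadraticFields.Quadratic.torsionOrder_eq_two_of_discr_lt_neg_four h2f hd4]
    intro h
    exact hp2 ((Nat.prime_dvd_prime_iff_eq hp Nat.prime_two).mp h)
  have hsplitq' : ∀ ℓ : ℕ, ℓ.Prime → ℓ ∣ N → ℓ ≠ 2 → ((Ideal.span {(ℓ : ℤ)}).primesOver (𝓞 K)).ncard = 2 := by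
    rw [← hN]; exact hsplitq
  ---------------------------------------------------------------- rank one and finite `Ш` over `K` by descent
  have hrW : W.analyticRank ≤ 1 := by omega
  have hrd : Wd.analyticRank ≤ 1 := by omega
  obtain ⟨hrankW, hShaW⟩ := hGZK W hrW
  obtain ⟨hrankd, hShad⟩ := hGZK Wd hrd
  have hrt : (W.quadraticTwist (NumberField.discr K : ℚ)).analyticRank = Wd.analyticRank := by
    rw [← analyticRank_smul (W.quadraticTwist _) Cd, hWd]
  have hrkt : (W.quadraticTwist (NumberField.discr K : ℚ)).mordellWeilRank = Wd.analyticRank := by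
    rw [(hGZK _ (by omega : (W.quadraticTwist (NumberField.discr K : ℚ)).analyticRank ≤ 1)).1, hrt]
  haveI : Module.Finite ℤ (W.baseChange K).toAffine.Point := (W.baseChange K).module_finite_point_holds
  have hrank : (W.baseChange K).mordellWeilRank = 1 := by
    rw [W.mordellWeilRank_baseChange_of_finrank_eq_two_of_finite K h2f, hrankW, hrkt, hsum]
  have hShat : (W.quadraticTwist (NumberField.discr K : ℚ)).ShaFinite := by
    have h : (Cd • W.quadraticTwist (NumberField.discr K : ℚ)).ShaFinite ↔
        (W.quadraticTwist (NumberField.discr K : ℚ)).ShaFinite :=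
      shaFinite_variableChange_iff_holds (W.quadraticTwist (NumberField.discr K : ℚ)) Cd
    rw [hWd] at h
    exact h.mp hShad
  have hSha : (W.baseChange K).ShaFinite :=
    Literature.NumberTheory.EllipticCurves.shaFinite_baseChange_of_shaFinite W K h2f hShaW hShat
  ---------------------------------------------------------------- CTL₀ at the frame `(κ, γ, 𝔭)`, at the point `Q`
  obtain ⟨n, hn, -⟩ := TameJointLower.additiveControlLeOnTreeAt_of_rankOne_of_shaFinite W p hp2 K hKiq hsplit hpN
    hadd hunit hrank hSha Q hQnt κ hκ γ 𝔭 h𝔭 he hf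
  have htorsX : Module.IsTorsion (IwasawaAlgebra p) (XAc (W.baseChange K) p κ 𝔭 ∅ γ) := hn.1
  ---------------------------------------------------------------- the ♭-frame of unit content at the conjugate prime
  obtain ⟨𝔭', hne, h𝔭', he', hf'⟩ := X11b.Three.exists_ne_degreeOne_prime h2f h𝔭 he hf
  obtain ⟨ι₀⟩ := PadicAlgCl.nonempty_ringEquiv_complex p
  obtain ⟨ι', -, hind⟩ := exists_datum_forall_mem_iff p ι₀ hKiq h𝔭'
  obtain ⟨ΩK, Ωp', Qf, hΩK, hBDP, hμ⟩ := exists_frameInt_unitContent_twisted_two hB W K 𝔭' κ γ Dt.f Dt.isNewformOf t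
    hp2 hpN' hKiq hsplit h𝔭' ht h2d hmult₂ hbc hsplitq' hcut hirr hκ ι' hind
  have hΩp : ((Ωp' : unrIntegers p) : ℂ_[p]) ≠ 0 := TameWaldspurger.coe_units_unrIntegers_ne_zero Ωp'
  -- the ♭-inclusion over the dyadic twisted road field: frame at `𝔭′`, module at `𝔭`
  have hle : (XAc.charIdeal (W.baseChange K) p κ 𝔭 ∅ γ).map (PowerSeries.map (R1.toCpInt p)) ≤ Ideal.span {Qf} :=
    flatInclusion_twisted_two hB h821 h61 W p K hcell h5 hsurj htt hK N Dt hN κ hκ γ 𝔭' h𝔭' he' hf' 𝔭 h𝔭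
      hne.symm ι' hind ΩK _ Qf hΩK hΩp hBDP htorsX hμ
  ---------------------------------------------------------------- the value of the frame at `𝟙`: LZZ-twisted (R4₂) at `(ι′, 𝔭′)` and the transport
  obtain ⟨lam, hlam1, hLS⟩ := hHT ι' 𝔭' h𝔭' he' hf' hind
  have hlog' : logOmega W p (embAt K p 𝔭' h𝔭' he' hf') Q ≠ 0 := X11b.R1.logOmega_ne_zero W p _ hQnt
  have hlam0 : lam ≠ 0 := fun h0 ↦ by rw [h0, norm_zero] at hlam1; exact zero_ne_one hlam1
  have hLSne : heegnerCharLogSum ι' w₀.embedding 1 W₁ ν y ≠ 0 := by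
    rw [hLS]
    exact mul_ne_zero hlam0 ((map_ne_zero _).mpr hlog')
  obtain ⟨u, hu, hval⟩ := TameWaldspurger.intSeries_value_of_frame_manin_twisted_two hL W W₁ K 𝔭' κ γ Dt.f Dt₁
    w₀.embedding β y ν νgal emb t C hN hN₁ hp2N hC hp2 hKiq hd4 hsplit h𝔭' ht h2d hmult₂ hbc hsplitq' hcut hκ
    Dt.isNewformOf hemb hinfl hrat hβ hy ι' hind (hind w₀) hLSne hΩK hΩp hBDP
  -- the Manin constant of `W₁`'s parametrisation
  have hc0 : Dt₁.c ≠ 0 := Dt₁.maninConstant_ne_zero_holds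
  have hc0' : (Dt₁.c : ℚ_[p]) ≠ 0 := by exact_mod_cast hc0
  have hcalg : algebraMap ℚ_[p] ℂ_[p] (Dt₁.c : ℚ_[p]) = (Dt₁.c : ℂ_[p]) := map_intCast _ Dt₁.c
  -- transport the logarithm from the embedding of `𝔭′` to that of `𝔭` (rank one), and absorb `λ²` into the unit
  have hlog : logOmega W p (embAt K p 𝔭 h𝔭 he hf) Q ≠ 0 := X11b.R1.logOmega_ne_zero W p _ hQnt
  have hsq : (algebraMap ℚ_[p] ℂ_[p] (logOmega W p (embAt K p 𝔭' h𝔭' he' hf') Q / (Dt₁.c : ℚ_[p]))) ^ 2 =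
      (algebraMap ℚ_[p] ℂ_[p] (logOmega W p (embAt K p 𝔭 h𝔭 he hf) Q / (Dt₁.c : ℚ_[p]))) ^ 2 := by
    rw [← map_pow, ← map_pow, div_pow, div_pow,
      SchneiderFreeAdditiveX3.sq_logOmega_embAt_eq_of_rank_one W p h2f hrank h𝔭 he hf h𝔭' he' hf' Q]
  have hrew : u * (heegnerCharLogSum ι' w₀.embedding 1 W₁ ν y / (Dt₁.c : ℂ_[p])) ^ 2 =
      (u * lam ^ 2) * (algebraMap ℚ_[p] ℂ_[p] (logOmega W p (embAt K p 𝔭 h𝔭 he hf) Q / (Dt₁.c : ℚ_[p]))) ^ 2 := by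
    rw [← hsq, map_div₀, hcalg, hLS]
    ring
  have hu' : ‖u * lam ^ 2‖ = 1 := by rw [norm_mul, norm_pow, hu, hlam1, one_pow, one_mul]
  have hval' : IntSeries.HasValueAt Qf 0
      ((u * lam ^ 2) * (algebraMap ℚ_[p] ℂ_[p] (logOmega W p (embAt K p 𝔭 h𝔭 he hf) Q / (Dt₁.c : ℚ_[p]))) ^ 2) := by
    rw [← hrew]; exact hval
  ---------------------------------------------------------------- the `𝓞_{ℂ_p}` receptacle
  obtain ⟨htors, fI, hfI, hf0, hfn⟩ := hn
  have hmem : PowerSeries.map (R1.toCpInt p) fI ∈ Ideal.span {Qf} := by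
    have h3 := hle
    rw [hfI, map_span_singleton_powerSeries] at h3
    exact (Ideal.span_singleton_le_iff_mem _).mp h3
  obtain ⟨-, hle'⟩ := int_two_mul_valuation_le_of_map_mem_span hf0 hmem hu' hval'
  rw [div_eq_mul_inv, Padic.valuation_mul hlog (inv_ne_zero hc0'), Padic.valuation_inv,
    Padic.valuation_intCast, valuation_logOmega hlog, hfn] at hle'
  refine ⟨n, ⟨htors, fI, hfI, hf0, hfn⟩, ?_⟩
  simp only [padicValInt] at hle'
  linarith

end Socket

end Summit.BirchSwinnertonDyer.BirchSwinnertonDyer.Theorems.TwistedWanRoad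

end
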